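import Mathlib
import HarnessLib
import Literature.AlgebraicGeometry.Resolution.BirationalDimensionInequality
import Summits.ResolutionOfSingularities.ResolutionOfSingularities.Theorems.WildQuotientsWildQuotientResolutionS1aReach

/-!
# S1a — (D4) THE DIMENSION OF A MODEL and (D2) `ν₁ ≤ 2` (typed)

[OURS · L1 W4.5c · lead-1 g8; plan-1 g12 STRATEGY-DESIGN v3.3 §0 / v3.5 §4 row (3): «consequences to type as lemmas, never to bake into the class»] — NOT
statements of the manuscript; counted 0; AI-level work, weaker than expert review. Crux stmt-ResolutionOfSingularities-17941, line `s1a-logminvertex` v6.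

* **(D4)** `GameFrame.GModel.topologicalKrullDim_eq` — `dim M.V = dim X′` for EVERY model (proper birational between integral schemes, `X′` locally
  Noetherian: `IsBirational.topologicalKrullDim_eq_of_isProper`); `topologicalKrullDim_eq_base` — `= dim X₁` when `q` is finite surjective
  (`Motives.Scheme.topologicalKrullDim_eq_of_isFinite_of_surjective`); hence on crux data `jInf M ≤ ν₁ M ≤ dim M.V ≤ 4` (`nu1_le_four_of_datum`,
  `jInf_le_four_of_datum`).
* **(D2)** `Nu1LeTwoReach p` (research def, OURS CANDIDATE, asserted nowhere): on the reachable models of crux data `ν₁ ≤ 2` (bad locus of codimension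
  ≥ 2: bad ⊆ Fix(g₀) ∩ V(J′), `J′` the augmentation ideal stripped of its divisorial part — Király–Lütkebohmert: augmentation ideal principal ⇒ invariants
  regular ⇒ good); consequence `jInf ∈ {⊥, 0, 1, 2}` (`jInf_le_two_of_nu1LeTwoReach`), the input of plan-1ʼs prediction (T6) «≤ 3 AUX moves per branch».
-/

set_option linter.dupNamespace false

noncomputable section

open CategoryTheory Limits AlgebraicGeometry TopologicalSpace Topology
open Literature.AlgebraicGeometry.Resolution Literature.AlgebraicGeometry.RelativeSpec
open Summit.ResolutionOfSingularities.ResolutionOfSingularities.Theorems.WildQuotientResolution.S1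
open Summit.ResolutionOfSingularities.ResolutionOfSingularities.Theorems.WildQuotientResolution.S1.NodeAtlas

namespace Summit.ResolutionOfSingularities.ResolutionOfSingularities.Theorems.WildQuotientResolution.S1

namespace GameFrame.GModel

variable {p : ℕ} {X' X₁ : Scheme.{0}} {q : X' ⟶ X₁} {G : Type} [Group G] {ρ : G →* Aut X'} {g₀ : G}

/-- **(D4) `dim M.V = dim X′`** for every model: `M.π` is proper birational between integral schemes and `X′` is locally Noetherian.
[OURS · L1 W4.5c] -/
theorem topologicalKrullDim_eq [IsIntegral X'] [IsLocallyNoetherian X'] (M : GModel p q G ρ g₀) :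
    topologicalKrullDim M.V = topologicalKrullDim X' := by
  haveI := M.isProper
  haveI := M.isIntegral
  exact M.isBirational.topologicalKrullDim_eq_of_isProper

/-- **(D4′) `dim M.V = dim X₁`** when `q : X′ → X₁` is finite and surjective. [OURS · L1 W4.5c] -/
theorem topologicalKrullDim_eq_base [IsIntegral X'] [IsLocallyNoetherian X'] [IsFinite q] (hqs : Function.Surjective q.base)
    (M : GModel p q G ρ g₀) : topologicalKrullDim M.V = topologicalKrullDim X₁ := by
  haveI : Surjective q := ⟨hqs⟩
  rw [M.topologicalKrullDim_eq]
  exact Literature.AlgebraicGeometry.Motives.Scheme.topologicalKrullDim_eq_of_isFinite_of_surjective q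

/-- `ν₁ M ≤ dim X₁` (finite surjective `q`). -/
theorem nu1_le_base [IsIntegral X'] [IsLocallyNoetherian X'] [IsFinite q] (hqs : Function.Surjective q.base) (M : GModel p q G ρ g₀) :
    M.nu1 ≤ topologicalKrullDim X₁ :=
  M.nu1_le.trans (M.topologicalKrullDim_eq_base hqs).le

/-- `jInf M ≤ dim X₁` (finite surjective `q`). -/
theorem jInf_le_base [IsIntegral X'] [IsLocallyNoetherian X'] [IsFinite q] (hqs : Function.Surjective q.base) (M : GModel p q G ρ g₀) :
    M.jInf ≤ topologicalKrullDim X₁ :=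
  M.jInf_le_nu1.trans (M.nu1_le_base hqs)

/-- **On crux data `ν₁ ≤ 4`**: `dim X₁ ≤ 4`, `q` finite surjective. [OURS · L1 W4.5c] -/
theorem nu1_le_four_of_datum [IsIntegral X'] [IsLocallyNoetherian X'] [IsFinite q] (hqs : Function.Surjective q.base)
    (hdim : topologicalKrullDim X₁ ≤ 4) (M : GModel p q G ρ g₀) : M.nu1 ≤ 4 :=
  (M.nu1_le_base hqs).trans hdim

/-- **On crux data `jInf ≤ 4`.** [OURS · L1 W4.5c] -/
theorem jInf_le_four_of_datum [IsIntegral X'] [IsLocallyNoetherian X'] [IsFinite q] (hqs : Function.Surjective q.base)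
    (hdim : topologicalKrullDim X₁ ≤ 4) (M : GModel p q G ρ g₀) : M.jInf ≤ 4 :=
  (M.jInf_le_base hqs).trans hdim

end GameFrame.GModel

/-! ## (D2) `ν₁ ≤ 2` on reachable models of crux data (research def) -/

/-- **(D2) `Nu1LeTwoReach p`** (plan-1 STRATEGY-DESIGN v3.3 §0; OURS CANDIDATE research statement, asserted nowhere): on every model REACHABLE from the
initial model of a crux datum (binders of `KillOrAuxRuleJInfReach`, verbatim) the bad locus has dimension `ν₁ ≤ 2` — i.e. codimension ≥ 2 in the
fourfold: bad ⊆ Fix(g₀) ∩ V(J′) with `J′` the augmentation ideal stripped of its divisorial part (Király–Lütkebohmert: augmentation ideal principal ⇒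
invariants regular ⇒ good). Research-S/M; consequence `jInf ∈ {⊥, 0, 1, 2}` feeds prediction (T6). [OURS · L1 W4.5c] -/
def Nu1LeTwoReach (p : ℕ) : Prop :=
  ∀ (k : Type) [Field k] [CharP k p] [PerfectField k] (X' X₁ : Scheme.{0})
    (f : X₁ ⟶ Spec (.of k)) (q : X' ⟶ X₁) (G : Type) [Group G] [Finite G]
    (ρ : G →* Aut X'), Nat.card G = p → IsSeparated f → LocallyOfFiniteType f → QuasiCompact f →
    IsIntegral X₁ → ∀ [IsIntegral X'], Scheme.IsRegular X' → IsFinite q → Function.Surjective q.base →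
    (∃ U : X₁.Opens, Dense (U : Set X₁) ∧ Etale (q ∣_ U)) →
    ∀ (hq : ∀ g : G, (ρ g).hom ≫ q = q),
    (∀ x y : X', q.base x = q.base y → ∃ g : G, (ρ g).hom.base x = y) →
    topologicalKrullDim X₁ ≤ 4 → Function.Injective ρ →
    ∀ (g₀ : G), (∀ g : G, g ∈ Subgroup.zpowers g₀) → ∀ [IsLocallyNoetherian X']
      (h₀ : NodeAtlas p (⟨ρ, hq⟩ : ActionOver q G) g₀),
      ∀ M : GameFrame.GModel p q G ρ g₀, (GameFrame.GModel.initial hq h₀).Reachable M → M.nu1 ≤ 2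

/-- **(D2) ⇒ `jInf ≤ 2`** on reachable models of crux data (so `jInf ∈ {⊥, 0, 1, 2}`: at most three AUX moves per branch, prediction (T6)).
[OURS · L1 W4.5c] -/
theorem jInf_le_two_of_nu1LeTwoReach {p : ℕ} (h : Nu1LeTwoReach p) :
    ∀ (k : Type) [Field k] [CharP k p] [PerfectField k] (X' X₁ : Scheme.{0})
    (f : X₁ ⟶ Spec (.of k)) (q : X' ⟶ X₁) (G : Type) [Group G] [Finite G]
    (ρ : G →* Aut X'), Nat.card G = p → IsSeparated f → LocallyOfFiniteType f → QuasiCompact f →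
    IsIntegral X₁ → ∀ [IsIntegral X'], Scheme.IsRegular X' → IsFinite q → Function.Surjective q.base →
    (∃ U : X₁.Opens, Dense (U : Set X₁) ∧ Etale (q ∣_ U)) →
    ∀ (hq : ∀ g : G, (ρ g).hom ≫ q = q),
    (∀ x y : X', q.base x = q.base y → ∃ g : G, (ρ g).hom.base x = y) →
    topologicalKrullDim X₁ ≤ 4 → Function.Injective ρ →
    ∀ (g₀ : G), (∀ g : G, g ∈ Subgroup.zpowers g₀) → ∀ [IsLocallyNoetherian X']
      (h₀ : NodeAtlas p (⟨ρ, hq⟩ : ActionOver q G) g₀),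
      ∀ M : GameFrame.GModel p q G ρ g₀, (GameFrame.GModel.initial hq h₀).Reachable M → M.jInf ≤ 2 := by
  intro k _ _ _ X' X₁ f q G _ _ ρ hG hfs hfft hfqc hX₁ _ hreg hqfin hqs hqet hq horb hdim hinj g₀ hg₀ _ h₀ M hR
  exact M.jInf_le_nu1.trans (h k X' X₁ f q G ρ hG hfs hfft hfqc hX₁ hreg hqfin hqs hqet hq horb hdim hinj g₀ hg₀ h₀ M hR)

/-- **Unconditionally `jInf ≤ 4` on reachable models of crux data** ((D4′); no (D2) needed). [OURS · L1 W4.5c] -/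
theorem jInf_le_four_of_datum' {p : ℕ} :
    ∀ (k : Type) [Field k] [CharP k p] [PerfectField k] (X' X₁ : Scheme.{0})
    (f : X₁ ⟶ Spec (.of k)) (q : X' ⟶ X₁) (G : Type) [Group G] [Finite G]
    (ρ : G →* Aut X'), Nat.card G = p → IsSeparated f → LocallyOfFiniteType f → QuasiCompact f →
    IsIntegral X₁ → ∀ [IsIntegral X'], Scheme.IsRegular X' → IsFinite q → Function.Surjective q.base →
    (∃ U : X₁.Opens, Dense (U : Set X₁) ∧ Etale (q ∣_ U)) →
    ∀ (hq : ∀ g : G, (ρ g).hom ≫ q = q),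
    (∀ x y : X', q.base x = q.base y → ∃ g : G, (ρ g).hom.base x = y) →
    topologicalKrullDim X₁ ≤ 4 → Function.Injective ρ →
    ∀ (g₀ : G), (∀ g : G, g ∈ Subgroup.zpowers g₀) → ∀ [IsLocallyNoetherian X']
      (h₀ : NodeAtlas p (⟨ρ, hq⟩ : ActionOver q G) g₀),
      ∀ M : GameFrame.GModel p q G ρ g₀, M.jInf ≤ 4 := by
  intro k _ _ _ X' X₁ f q G _ _ ρ hG hfs hfft hfqc hX₁ _ hreg hqfin hqs hqet hq horb hdim hinj g₀ hg₀ _ h₀ M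
  haveI := hqfin
  exact M.jInf_le_four_of_datum hqs hdim

end Summit.ResolutionOfSingularities.ResolutionOfSingularities.Theorems.WildQuotientResolution.S1

end
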